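import Summits.QuantumFields.YangMills.Theorems.BalabanUVNodesPortS1RecordDtJacBlock
import Summits.QuantumFields.YangMills.Theorems.BalabanUVNodesPortS1ZkGraph

/-!
# Port S1, socket (o3)-IX — `det(1 ± h_ℂ ∘L A)` IS THE DETERMINANT OF ITS `b₀`-BLOCK (block-triangular along `CoarseIdx ⊕ NonB0Idx ≃ FluctIdx`; [I] p.267 «hB is equal to 0 everywhere,
# except the set {b₀(c)}», (2.12) p.268: the `D̃`-Jacobian `det(1 − h δD̃∕δB)` is a determinant over the CENTRAL coordinates `(b₀(c), j)` only — `3·#T^{(k+1)}` of them, not `3·#T^{(k)}`)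

Cell `ym-nodeO-ideate`, porter seat PT-A-1 (gen 10); `--kind proof --supports stmt-QuantumFields-27930 --as helper`; count-neutral.  [I] = [Balaban1987RG1].
Over ✓`…PortS1RecordDtJacBlock` (p829303: `1 ± h_ℂ∘A` is the identity on non-`b₀` coordinates) and ✓`…PortS1ZkGraph.blkToFluct_bijective` (the block reindexing is a bijection for `k + 1 ≤ m + K`).

WHAT IS PROVED (HYPOTHESIS-FREE in the operator `A : 𝒴 →L[ℂ] 𝒳`, `𝒴 = FluctIdx → ℂ`, `𝒳 = PBond^{(k+1)} → MatA 2`; only `k + 1 ≤ m + K`):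
* `single_b0_apply_of_not_mem`, `toMatrix_one_sub_hop_comp_inr_inl` (the lower-left block of `1 − h_ℂ∘A` in the block index is `0`), `toMatrix_one_sub_hop_comp_inr_inr` (the lower-right block is `1`);
* ★★★ `det_one_sub_hop_comp_eq_det_b0Block` — `det(1 − h_ℂ ∘L A) = det [ ((1 − h_ℂ∘A) e_{(b₀c′, j′)})_{(b₀c, j)} ]_{(c,j),(c′,j′)}` (Mathlib `det_fromBlocks_zero₂₁` after `det_submatrix_equiv_self`);
  ★★ `det_one_add_hop_comp_eq_det_b0Block` (same for `1 + h_ℂ ∘L A`, i.e. for `DΨ(B′) = 1 + h_ℂ∘DC̃_ℂ(B′)`); so (o3)'s `det DΨ(B′)`, `det DΦ(B)` and their `Tr log` are `b₀`-BLOCK quantities.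

HONEST FRAMING.  Finite-dimensional linear algebra; nothing of Bałaban's renormalization-group estimates asserted, ported or discharged; the fibre-density identity `|det ∂_{b₀}Q̃|⁻¹ = |det A₁|⁻¹·|det DΦ|` and
the locality of the block entries are NOT here; `stub_FE(step)` (XXL) ∕ `stub_P0C` OPEN, ⟨27930⟩ OPEN (1∕3); NODE O 0∕1; COUNT 8∕28 · K 1∕4 UNMOVED; finite `𝕋⁴_{L^K}` at fixed ε — NOT continuum ∕ OS;
**the Yang–Mills mass gap (Clay) is NOT proved by any of this.**  No `sorry`, no `def`, no `instance`; standard axioms only.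
-/

noncomputable section

open scoped BigOperators Matrix.Norms.L2Operator Topology

namespace Summit.QuantumFields.YangMills.Theorems.BalabanUVNodesPortS1

open Summit.QuantumFields.YangMills.Theorems.K0RecordFormatNames
open Literature.MathematicalPhysics.QuantumFieldTheory.Balaban1983to89
open Literature.MathematicalPhysics.QuantumFieldTheory.Balaban1983to89.Node00
open Literature.MathematicalPhysics.QuantumFieldTheory.Balaban1983to89.T4Continuum (T4Family)
open _root_.Matrix

variable (F : T4Family)

/-- A `b₀`-coordinate vector vanishes at every non-`b₀` coordinate. [cite: Balaban1987RG1, p.267 (bookkeeping)] -/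
theorem single_b0_apply_of_not_mem (k K : ℕ) (cj : CoarseIdx F k K) (i : FluctIdx F k K) (hi : i.1 ∉ Set.range (recordB0 F k K)) :
    (Pi.single ((recordB0 F k K cj.1, cj.2) : FluctIdx F k K) (1 : ℂ) : FluctIdx F k K → ℂ) i = 0 := by
  classical
  have hne : i ≠ (recordB0 F k K cj.1, cj.2) := by
    rintro rfl
    exact hi ⟨cj.1, rfl⟩
  simp [hne]

section Block

variable {F}
variable {k K : ℕ} (hk : k + 1 ≤ (F.P K).m + (F.P K).K) (Vk : GaugeField (F.P K) k (SU 2))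

/-- The matrix of an operator `T` on `FluctIdx → ℂ` in the block index `CoarseIdx ⊕ NonB0Idx` (reindexed along `blkToFluct`), entry `(p, q) = (T e_{e q})_{e p}`. [folklore] -/
theorem toMatrix'_submatrix_blkToFluct_apply (T : (FluctIdx F k K → ℂ) →L[ℂ] (FluctIdx F k K → ℂ)) (p q : CoarseIdx F k K ⊕ NonB0Idx F k K) :
    (LinearMap.toMatrix' (T : (FluctIdx F k K → ℂ) →ₗ[ℂ] (FluctIdx F k K → ℂ))).submatrix (blkToFluct F k K) (blkToFluct F k K) p q =
      T (Pi.single (blkToFluct F k K q) 1) (blkToFluct F k K p) := by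
  classical
  rw [Matrix.submatrix_apply, LinearMap.toMatrix'_apply]
  rfl

include hk in
/-- THE LOWER-LEFT BLOCK OF `1 − h_ℂ ∘L A` VANISHES: `((1 − h_ℂ∘A) e_{(b₀ c′, j′)})_i = 0` for a non-`b₀` coordinate `i`. [cite: Balaban1987RG1, p.267] -/
theorem toMatrix_one_sub_hop_comp_inr_inl (A : (FluctIdx F k K → ℂ) →L[ℂ] (PBond (F.P K) (k + 1) → MatA 2)) (i : NonB0Idx F k K) (cj : CoarseIdx F k K) :
    (((1 : (FluctIdx F k K → ℂ) →L[ℂ] (FluctIdx F k K → ℂ)) - (LinearMap.toContinuousLinearMap (hopLinGraphC F k K Vk)).comp A)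
        (Pi.single (blkToFluct F k K (Sum.inl cj)) 1)) (blkToFluct F k K (Sum.inr i)) = 0 := by
  have _ := hk
  show (((1 : (FluctIdx F k K → ℂ) →L[ℂ] (FluctIdx F k K → ℂ)) - (LinearMap.toContinuousLinearMap (hopLinGraphC F k K Vk)).comp A)
        (Pi.single ((recordB0 F k K cj.1, cj.2) : FluctIdx F k K) 1)) i.1 = 0
  rw [one_sub_hop_comp_apply_of_not_mem F k K Vk A _ i.1 i.2]
  exact single_b0_apply_of_not_mem F k K cj i.1 i.2

/-- THE LOWER-RIGHT BLOCK OF `1 − h_ℂ ∘L A` IS THE IDENTITY. [cite: Balaban1987RG1, p.267] -/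
theorem toMatrix_one_sub_hop_comp_inr_inr (A : (FluctIdx F k K → ℂ) →L[ℂ] (PBond (F.P K) (k + 1) → MatA 2)) (i i' : NonB0Idx F k K) :
    (((1 : (FluctIdx F k K → ℂ) →L[ℂ] (FluctIdx F k K → ℂ)) - (LinearMap.toContinuousLinearMap (hopLinGraphC F k K Vk)).comp A)
        (Pi.single (blkToFluct F k K (Sum.inr i')) 1)) (blkToFluct F k K (Sum.inr i)) = (1 : Matrix (NonB0Idx F k K) (NonB0Idx F k K) ℂ) i i' := by
  classical
  show (((1 : (FluctIdx F k K → ℂ) →L[ℂ] (FluctIdx F k K → ℂ)) - (LinearMap.toContinuousLinearMap (hopLinGraphC F k K Vk)).comp A)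
        (Pi.single (i'.1 : FluctIdx F k K) 1)) i.1 = _
  rw [one_sub_hop_comp_apply_of_not_mem F k K Vk A _ i.1 i.2, Matrix.one_apply, Pi.single_apply]
  simp only [Subtype.ext_iff]

include hk in
/-- ★★★ **`det(1 − h_ℂ ∘L A)` IS THE DETERMINANT OF ITS `b₀`-BLOCK**: for every operator `A : 𝒴 →L[ℂ] 𝒳`,
`det(1 − h_ℂ ∘L A) = det [((1 − h_ℂ∘A) e_{(b₀c′,j′)})_{(b₀c,j)}]` — in the block index `(b₀-coordinates) ⊕ (remaining)` the operator is `[[M₁₁, M₁₂],[0, 1]]`.  With `A := DD̃(B)` this is print's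
`det(1 − h δD̃∕δB)`, a `3·#T^{(k+1)}`-dimensional determinant. [cite: Balaban1987RG1, (2.12) p.268, p.267] -/
theorem det_one_sub_hop_comp_eq_det_b0Block (A : (FluctIdx F k K → ℂ) →L[ℂ] (PBond (F.P K) (k + 1) → MatA 2)) :
    LinearMap.det (((1 : (FluctIdx F k K → ℂ) →L[ℂ] (FluctIdx F k K → ℂ)) - (LinearMap.toContinuousLinearMap (hopLinGraphC F k K Vk)).comp A).toLinearMap) =
      Matrix.det (fun cj c'j' : CoarseIdx F k K =>
        (((1 : (FluctIdx F k K → ℂ) →L[ℂ] (FluctIdx F k K → ℂ)) - (LinearMap.toContinuousLinearMap (hopLinGraphC F k K Vk)).comp A)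
          (Pi.single ((recordB0 F k K c'j'.1, c'j'.2) : FluctIdx F k K) 1)) (recordB0 F k K cj.1, cj.2)) := by
  classical
  set T := ((1 : (FluctIdx F k K → ℂ) →L[ℂ] (FluctIdx F k K → ℂ)) - (LinearMap.toContinuousLinearMap (hopLinGraphC F k K Vk)).comp A) with hT
  set e : CoarseIdx F k K ⊕ NonB0Idx F k K ≃ FluctIdx F k K := Equiv.ofBijective _ (blkToFluct_bijective F k K hk) with he
  -- `det T = det M`, `M` its standard matrix; reindex along `e`
  rw [← LinearMap.det_toMatrix' (T : (FluctIdx F k K → ℂ) →ₗ[ℂ] (FluctIdx F k K → ℂ)),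
    ← Matrix.det_submatrix_equiv_self e (LinearMap.toMatrix' (T : (FluctIdx F k K → ℂ) →ₗ[ℂ] (FluctIdx F k K → ℂ)))]
  set N := (LinearMap.toMatrix' (T : (FluctIdx F k K → ℂ) →ₗ[ℂ] (FluctIdx F k K → ℂ))).submatrix e e with hN
  have hNapply : ∀ p q, N p q = T (Pi.single (blkToFluct F k K q) 1) (blkToFluct F k K p) := fun p q => by
    rw [hN]; exact toMatrix'_submatrix_blkToFluct_apply T p q
  -- block decomposition with zero lower-left block and identity lower-right block
  have h21 : N.toBlocks₂₁ = 0 := by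
    ext i cj
    rw [Matrix.toBlocks₂₁, Matrix.of_apply, hNapply]
    exact toMatrix_one_sub_hop_comp_inr_inl hk Vk A i cj
  have h22 : N.toBlocks₂₂ = 1 := by
    ext i i'
    rw [Matrix.toBlocks₂₂, Matrix.of_apply, hNapply]
    exact toMatrix_one_sub_hop_comp_inr_inr Vk A i i'
  have h11 : N.toBlocks₁₁ = fun cj c'j' : CoarseIdx F k K =>
      T (Pi.single ((recordB0 F k K c'j'.1, c'j'.2) : FluctIdx F k K) 1) (recordB0 F k K cj.1, cj.2) := by
    ext cj c'j'
    rw [Matrix.toBlocks₁₁, Matrix.of_apply, hNapply]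
    rfl
  rw [← Matrix.fromBlocks_toBlocks N, h21, h22, Matrix.det_fromBlocks_zero₂₁, Matrix.det_one, mul_one, h11]

include hk in
/-- ★★ **`det(1 + h_ℂ ∘L A)` IS THE DETERMINANT OF ITS `b₀`-BLOCK** — the `DΨ(B′) = 1 + h_ℂ∘DC̃_ℂ(B′)` form (apply the `−A` case). [cite: Balaban1987RG1, (2.12) p.268, p.267] -/
theorem det_one_add_hop_comp_eq_det_b0Block (A : (FluctIdx F k K → ℂ) →L[ℂ] (PBond (F.P K) (k + 1) → MatA 2)) :
    LinearMap.det (((1 : (FluctIdx F k K → ℂ) →L[ℂ] (FluctIdx F k K → ℂ)) + (LinearMap.toContinuousLinearMap (hopLinGraphC F k K Vk)).comp A).toLinearMap) =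
      Matrix.det (fun cj c'j' : CoarseIdx F k K =>
        (((1 : (FluctIdx F k K → ℂ) →L[ℂ] (FluctIdx F k K → ℂ)) + (LinearMap.toContinuousLinearMap (hopLinGraphC F k K Vk)).comp A)
          (Pi.single ((recordB0 F k K c'j'.1, c'j'.2) : FluctIdx F k K) 1)) (recordB0 F k K cj.1, cj.2)) := by
  have hneg : ((1 : (FluctIdx F k K → ℂ) →L[ℂ] (FluctIdx F k K → ℂ)) + (LinearMap.toContinuousLinearMap (hopLinGraphC F k K Vk)).comp A) =
      ((1 : (FluctIdx F k K → ℂ) →L[ℂ] (FluctIdx F k K → ℂ)) - (LinearMap.toContinuousLinearMap (hopLinGraphC F k K Vk)).comp (-A)) := by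
    rw [ContinuousLinearMap.comp_neg, sub_neg_eq_add]
  rw [hneg]
  exact det_one_sub_hop_comp_eq_det_b0Block hk Vk (-A)

end Block

end Summit.QuantumFields.YangMills.Theorems.BalabanUVNodesPortS1

end
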